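import Summits.BirchSwinnertonDyer.BirchSwinnertonDyer.Theorems.SignedLowerHalvesKobayashiLowerHalfLargeImageParityStratum
import Summits.BirchSwinnertonDyer.BirchSwinnertonDyer.Theorems.ThetaPartnerAtTwoSignedKatoUpToAtTwoIwasawaInvolutionCompat
import Summits.BirchSwinnertonDyer.Rank1Residual.Supersingular.KobayashiMainConjecture
import Literature.NumberTheory.EllipticCurves.Kobayashi2003.SignedSelmerDualInvolutionTwistProofs
import Literature.NumberTheory.EllipticCurves.Sprung2017.SharpFlatFunctionalEquationApZeroProofs
import HarnessLib

/-!
# Route `SignedLowerHalves` (K3), cruxes 2–4 (items stmt-BirchSwinnertonDyer-19000/19001/19002): THE KEYING DOOR, part 1 —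
# the functional equation `ι(L_p^ε) = u · L_p^ε` in K3's currency and the algebra transporting the three K3 shapes
# (main conjecture / Eisenstein half / `p`-inverted `λ`-shape) across the `γ ↦ γ⁻¹` re-keying of the signed dual

Cell `bsd-ssimc`, seat `bsd-line-slh-p3` LEAD gen 12 (helper file `--supports stmt-BirchSwinnertonDyer-19002`; the second,
genuinely new half of the pen's S35-8 lane — the first half, the `ι`-twist DICTIONARY for
`Kobayashi2003.SignedSelmerDualData`, is width seat `bsd-line-slh-p1-w7`'s Literature file
`Kobayashi2003/SignedSelmerDualInvolutionTwistProofs.lean` (+ this seat's §4 there), imported here). Part 2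
(`…KobayashiMainConjectureKeyingDoor.lean`) states the doors for the NAMED K3 statements. HONEST FRAMING: THEOREMS ONLY —
no definition, no named fact, no instance, no `sorry`; route-independent (no `Theses` import); closes no item; nothing
about any curve is asserted; BSD / cruxes 2–5 are NOT proved by any of this.

## Why (director (266) KEYING RULING R1′, pen S35-8 «K3 untouched — make it a kernel fact, not a reading»)

The tree's signed dual `D : Kobayashi2003.SignedSelmerDualData W κ γ ε` lets `T` act by PRE-composition,
`(T·x)(s) = x(conj_γ s) − x(s)` (the contragredient action of `γ⁻¹`), whereas print (Kobayashi Def. 1.1, Kato §13)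
gives the Pontryagin dual the contragredient action of `Γ`; with `1 + T ↦ γ` on both sides the dual OF PRINT is the
tree's datum of key `γ⁻¹` and the tree's key-`γ` datum is its Iwasawa-involution twist `(X^ε)^ι`
(`ι : T ↦ (1+T)⁻¹ − 1 = IwasawaAlgebra.invol p`; dictionary: `signedSelmerDualData_charIdeal_inv_eq_span_iff`,
`…_isTorsion_inv_iff`). The K3 deciding statements (`Rank1Residual.Supersingular.KobayashiMainConjecture`,
`KobayashiLowerDivisibility`, child 23118 `SmallImageLambdaLowerAtThree`) quantify over the KEY-`γ` data at the pinned
cyclotomic variable `γ` (`IsCyclotomicVariable p γ`). At crux 5 (`a_3 = ±3`, Sprung's ♯/♭) the analogous keying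
question made the leaf `SprungLowerDivisibilityAtThree` FALSE as typed (negative lemmas p660336 / p662508: the ♯/♭
ideals are not separately `ι`-stable). For Kobayashi's `±` theory at `a_p = 0` NOTHING of the kind can happen: the
principal ideal `(L_p^ε)` is `ι`-STABLE — the functional equation `L^•(T^ι) = σ (1+T)^{c+·} L^•` of a Sprung pair
at trace `0`, a tree THEOREM (`Sprung2017.cor414_sharpFlat_functionalEquation_apZero_holds`, Mazur–Tate–Teitelbaum
§I.17), applied to a Pollack pair (which IS a Sprung pair for trace `0`: `isSprungPair_zero_iff`) and read through
Kobayashi's labelling `kobayashiL ε L⁺ L⁻`.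

## What is proved here (all at a prime `p ≠ 2` of good reduction with `a_p = 0`)

* §1 **the functional equation in K3's currency**: `exists_isUnit_invol_kobayashiL_eq_mul` — for the newform `f` of
  `W` at level `N_E` and every Pollack pair, `ι(L_p^ε) = u · L_p^ε` with `u = w(E) · (1+T)^{c+e} ∈ Λˣ`, BOTH signs
  (cell `bsd-wall`'s `p = 2`, `ε = 1` instance `Invol.exists_isUnit_invol_kobayashiL_one_eq_mul` generalised);
  `span_invol_kobayashiL_eq` (`(ι L_p^ε) = (L_p^ε)`), `map_invol_span_kobayashiL_eq`.
* §2 **the algebra of the door** (any `L` with `ι L = u L`, `u ∈ Λˣ`, any `c : ℚ_p`, key-`γ` data `D` versus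
  key-`γ⁻¹` data `D′`): `iwasawaToPowerSeries_invol_of_eq` (push `ι` through `x^ℚ = C c · (L·y)^ℚ`), and the three
  shapes transported in BOTH directions: `mcShape_of_inv` / `mcShape_inv_of` (torsion ∧ `char = (g)`,
  `g^ℚ = C c · L^ℚ`), `lowerShape_of_inv` / `lowerShape_inv_of` (`char = (g)`, `g^ℚ = C c · (L h)^ℚ`),
  `lambdaShape_of_inv` / `lambdaShape_inv_of` (`char = (g)`, `(C p^m · g)^ℚ = C c · (L h)^ℚ`, same `m`).

References: [Kobayashi2003] Def. 1.1, Conjecture (p. 2), (3.6), Thm. 4.1; [Sprung2017] Cor. 4.14 (a_p = 0 display),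
§3.5; [MazurTateTeitelbaum1986Invent] Ch. I §17; [GreenbergLNM1716] §1 pp. 60, 67–68; [Greenberg1989] §0 pp. 101–102;
[Pollack2003] Prop. 6.18; [Kato2004Asterisque] §13. Tree: `Kobayashi2003/SignedSelmerDualInvolutionTwistProofs.lean`,
`ThetaPartnerAtTwoSignedKatoUpToAtTwoIwasawaInvolution{Twist,Compat}.lean`,
`ThetaPartnerAtTwoSignedKatoUpToAtTwoInvolFunctionalEquation.lean` (cell `bsd-wall`),
`SignedLowerHalvesKobayashiLowerHalfLargeImageParityStratum.lean` (`exists_sprung_exponents`).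
-/

set_option autoImplicit false
set_option linter.dupNamespace false

noncomputable section

open scoped Classical MatrixGroups ModularForm

open CongruenceSubgroup PowerSeries WeierstrassCurve Literature.NumberTheory.EllipticCurves
  Literature.NumberTheory.EllipticCurves.ModularForms Literature.Barriers.BirchSwinnertonDyer
  Literature.NumberTheory.EllipticCurves.Rank1Residual Literature.NumberTheory.EllipticCurves.Sprung2017
  Literature.NumberTheory.EllipticCurves.Kobayashi2003 ZpExtension
  Literature.NumberTheory.EllipticCurves.IwasawaAlgebra
  Summit.BirchSwinnertonDyer.Rank1Residual.Supersingular
  Summit.BirchSwinnertonDyer.BirchSwinnertonDyer.Theorems.SignedKatoOffTwo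

namespace Summit.BirchSwinnertonDyer.BirchSwinnertonDyer.Theorems.KobayashiKeyingDoor

/-! ## §1. The functional equation of `L_p^ε` in K3's currency (odd `p`, `a_p = 0`, both signs) -/

section FunctionalEquation

variable {W : WeierstrassCurve ℚ} [W.IsElliptic] [W.IsGloballyMinimal] {p : ℕ} [Fact p.Prime]

/-- **`ι(L_p^ε) = u · L_p^ε` with `u ∈ Λˣ`, for BOTH signs, at every odd good `p` with `a_p = 0`.** Let `f` be the
newform of `W` at level `N_E` and `(L⁺, L⁻)` a Pollack pair (`IsPollackPair`, Pollack's labelling; `kobayashiL ε`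
picks Kobayashi's `L_p^ε`). At level `N_E`, `f` is a Fricke eigenvector with sign `−w(E)`
(`rootNumber_eq_neg_frickeEigenvalue`), a Pollack pair is a Sprung pair for trace `0` (`isSprungPair_zero_iff`), and
Sprung's functional equation at `a_p = 0` is a tree THEOREM (`cor414_sharpFlat_functionalEquation_apZero_holds`):
`L♯(T^ι) = w (1+T)^{c+a} L♯`, `L♭(T^ι) = w (1+T)^{c+b} L♭` with `⟨N⟩ = η_N (1+p)^c`, `(p+1)a = −p`,
`(p+1)b = −1`; both multipliers are units (`w = ±1`, constant term `1`), and `IwasawaAlgebra.invol p` IS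
`T ↦ T^ι` (`Invol.invol_eq_subst_invOnePlusSubOne`). UNCONDITIONAL.
[cite: Sprung2017, Cor. 4.14 (a_p = 0 display) and §3.5] [cite: MazurTateTeitelbaum1986Invent, Ch. I §17]
[cite: Kobayashi2003, (3.6) (p. 7)] -/
theorem exists_isUnit_invol_kobayashiL_eq_mul (hp : p ≠ 2) (hgood : W.HasGoodReductionAtPrime p)
    (hap : W.frobeniusTrace p = 0) [NeZero (W.conductorNorm ℤ)] {f : CuspForm (Gamma0 (W.conductorNorm ℤ)) 2}
    (hf : IsNewformOf W f) {Lplus Lminus : IwasawaAlgebra p} (hPP : IsPollackPair f p Lplus Lminus) (ε : ℤˣ) :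
    ∃ u : IwasawaAlgebra p, IsUnit u ∧
      IwasawaAlgebra.invol p (kobayashiL ε Lplus Lminus) = u * kobayashiL ε Lplus Lminus := by
  -- the sign dictionary at level `N_W`: `w_N f = -w(E) f`
  have hw : (W.rootNumber : ℂ) = -frickeEigenvalue f :=
    rootNumber_eq_neg_frickeEigenvalue (fun _ _ ↦ IsNewform0.exists_functional_equation_holds)
      (fun _ _ ↦ IsNewform0.frickeEigenvalue_eq_one_or_eq_neg_one_holds) hf
  have hsm := IsNewform0.frickeInvolution_eq_smul_holds (N := W.conductorNorm ℤ) (k := (2 : ℤ)) hf.1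
  have hFr : IsFrickeEigen (W.conductorNorm ℤ) f (frickeEigenvalue f) :=
    isFrickeEigen_of_frickeInvolution_eq_smul _ hsm
  have hWσ : IsFrickeEigen (W.conductorNorm ℤ) f (-((W.rootNumber : ℤ) : ℂ)) := by
    rw [hw, neg_neg]; exact hFr
  have hσ : W.rootNumber ^ 2 = 1 := by
    rcases W.rootNumber_eq_one_or with h | h <;> rw [h] <;> norm_num
  -- the exponent of `⟨N⟩`, the constants `a, b`, the Sprung pair
  have hpN : ¬ p ∣ W.conductorNorm ℤ := not_dvd_level_of_isNewformOf hf hgood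
  obtain ⟨ηN, c, hc⟩ := exists_teichmuller_exponent_natCast p hpN
  obtain ⟨a, b, ha, hb⟩ := LargeImageParityStratum.exists_sprung_exponents (p := p)
  have hSP : IsSprungPair f p 0 Lplus Lminus :=
    (isSprungPair_zero_iff f p Lplus Lminus).mpr ⟨hPP.2.2.1, hPP.2.2.2⟩
  have hι : (1 + X : IwasawaAlgebra p) * ((invOnePlusSubOne : IwasawaAlgebra p) + 1) = 1 :=
    one_add_X_mul_invOnePlusSubOne_add_one
  obtain ⟨hs, hfl⟩ := cor414_sharpFlat_functionalEquation_apZero_holds p W (W.conductorNorm ℤ) f hp hf hgood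
    hap W.rootNumber hσ hWσ ηN c hc a b ha hb invOnePlusSubOne hι Lplus Lminus hSP
  -- the component of the sign `ε`
  obtain ⟨e, he⟩ : ∃ e : ℤ_[p], (kobayashiL ε Lplus Lminus).subst invOnePlusSubOne =
      (W.rootNumber : IwasawaAlgebra p) * binomialSeries ℤ_[p] e * kobayashiL ε Lplus Lminus := by
    unfold kobayashiL
    split_ifs
    · exact ⟨c + b, hfl⟩
    · exact ⟨c + a, hs⟩
  refine ⟨(W.rootNumber : IwasawaAlgebra p) * binomialSeries ℤ_[p] e, ?_, ?_⟩
  · refine IsUnit.mul ?_ ?_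
    · rcases W.rootNumber_eq_one_or with h | h
      · rw [h, Int.cast_one]; exact isUnit_one
      · rw [h, Int.cast_neg, Int.cast_one]; exact isUnit_one.neg
    · refine isUnit_iff_exists_inv.2 ⟨binomialSeries ℤ_[p] (-e), ?_⟩
      rw [← binomialSeries_add, add_neg_cancel, binomialSeries_zero]
  · rw [Invol.invol_eq_subst_invOnePlusSubOne, he]

/-- **`(ι L_p^ε) = (L_p^ε)` as ideals of `Λ`** (both signs; odd good `p`, `a_p = 0`). [cite: Sprung2017, Cor. 4.14 (a_p = 0 display)]
[cite: GreenbergLNM1716, §1 (p. 68: `f(T^ι)/f(T) ∈ Λ^×`)] -/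
theorem span_invol_kobayashiL_eq (hp : p ≠ 2) (hgood : W.HasGoodReductionAtPrime p)
    (hap : W.frobeniusTrace p = 0) [NeZero (W.conductorNorm ℤ)] {f : CuspForm (Gamma0 (W.conductorNorm ℤ)) 2}
    (hf : IsNewformOf W f) {Lplus Lminus : IwasawaAlgebra p} (hPP : IsPollackPair f p Lplus Lminus) (ε : ℤˣ) :
    Ideal.span {IwasawaAlgebra.invol p (kobayashiL ε Lplus Lminus)} = Ideal.span {kobayashiL ε Lplus Lminus} := by
  obtain ⟨u, hu, h⟩ := exists_isUnit_invol_kobayashiL_eq_mul hp hgood hap hf hPP ε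
  rw [h]
  exact Ideal.span_singleton_mul_left_unit hu _

/-- The same as an image: **`ι((L_p^ε)) = (L_p^ε)`** (`Ideal.map`). [cite: Sprung2017, Cor. 4.14 (a_p = 0 display)] -/
theorem map_invol_span_kobayashiL_eq (hp : p ≠ 2) (hgood : W.HasGoodReductionAtPrime p)
    (hap : W.frobeniusTrace p = 0) [NeZero (W.conductorNorm ℤ)] {f : CuspForm (Gamma0 (W.conductorNorm ℤ)) 2}
    (hf : IsNewformOf W f) {Lplus Lminus : IwasawaAlgebra p} (hPP : IsPollackPair f p Lplus Lminus) (ε : ℤˣ) :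
    (Ideal.span {kobayashiL ε Lplus Lminus}).map (IwasawaAlgebra.invol p).toRingHom =
      Ideal.span {kobayashiL ε Lplus Lminus} := by
  rw [Ideal.map_span, Set.image_singleton]
  exact span_invol_kobayashiL_eq hp hgood hap hf hPP ε

end FunctionalEquation

/-! ## §2. The algebra of the door: the three K3 shapes pass through the re-keying in both directions -/

section Shapes

variable {p : ℕ} [Fact p.Prime]

/-- `ι` commutes with the coefficient embedding `Λ ↪ ℚ_p⟦T⟧` (cell `bsd-wall`'s `iwasawaToPowerSeries_invol`, named-`ι`
spelling): `(ι f)^ℚ = (f^ℚ)(T^ι)`. [folklore] -/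
theorem iwasawaToPowerSeries_invol' (f : IwasawaAlgebra p) :
    iwasawaToPowerSeries p (IwasawaAlgebra.invol p f) =
      subst (invOnePlusSubOne : ℚ_[p]⟦X⟧) (iwasawaToPowerSeries p f) :=
  IwasawaInvolution.iwasawaToPowerSeries_invol _ (IwasawaInvolution.involEquiv_eq_subst p) f

/-- **Push `ι` through a K3-shaped identity.** If `ι L = u · L` in `Λ` and `x^ℚ = C c · (L · y)^ℚ` in `ℚ_p⟦T⟧`, then
`(ι x)^ℚ = C c · (L · (u · ι y))^ℚ` (`ι` is a ring map fixing constants and commuting with `Λ ↪ ℚ_p⟦T⟧`).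
[cite: GreenbergLNM1716, §1 (functional equation)] -/
theorem iwasawaToPowerSeries_invol_of_eq {L u x y : IwasawaAlgebra p} (hFE : IwasawaAlgebra.invol p L = u * L)
    {c : ℚ_[p]} (hx : iwasawaToPowerSeries p x = C c * iwasawaToPowerSeries p (L * y)) :
    iwasawaToPowerSeries p (IwasawaAlgebra.invol p x) =
      C c * iwasawaToPowerSeries p (L * (u * IwasawaAlgebra.invol p y)) := by
  rw [iwasawaToPowerSeries_invol', hx, subst_mul hasSubst_invOnePlusSubOne, ← iwasawaToPowerSeries_invol',
    map_mul (IwasawaAlgebra.invol p), hFE]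
  have hC : subst (invOnePlusSubOne : ℚ_[p]⟦X⟧) (C c : ℚ_[p]⟦X⟧) = C c := subst_C c
  rw [hC]
  congr 2
  ring

variable {W : WeierstrassCurve ℚ} {κ : ZpExtension ℚ p} {γ : Field.absoluteGaloisGroup ℚ} {ε : ℤˣ}

/-- **MC shape, contragredient ⇒ tree-keyed.** If `ι L = u L` (`u ∈ Λˣ`) and every key-`γ⁻¹` datum `D′` has
`X` torsion with `char = (g′)`, `g′^ℚ = C c · L^ℚ`, then every key-`γ` datum `D` has `X` torsion with `char = (g)`,
`g^ℚ = C c · L^ℚ` — `g := ι g′ · u⁻¹` (dictionary: torsion ⟺, `char D = (ι g′)`; `(ι g′)^ℚ = C c · (u L)^ℚ`).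
[cite: GreenbergLNM1716, §1 (p. 60)] [cite: Kobayashi2003, Conjecture (Main Conjecture) (p. 2) (the shape only)] -/
theorem mcShape_of_inv {L u : IwasawaAlgebra p} (hu : IsUnit u) (hFE : IwasawaAlgebra.invol p L = u * L)
    (c : ℚ_[p])
    (h : ∀ D' : SignedSelmerDualData W κ γ⁻¹ ε, Module.IsTorsion (IwasawaAlgebra p) D'.X ∧
      ∃ g : IwasawaAlgebra p, D'.charIdeal = Ideal.span {g} ∧
        iwasawaToPowerSeries p g = C c * iwasawaToPowerSeries p L)
    (D : SignedSelmerDualData W κ γ ε) :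
    Module.IsTorsion (IwasawaAlgebra p) D.X ∧
      ∃ g : IwasawaAlgebra p, D.charIdeal = Ideal.span {g} ∧
        iwasawaToPowerSeries p g = C c * iwasawaToPowerSeries p L := by
  obtain ⟨D', -, -, -⟩ := signedSelmerDualData_exists_involTwist (mul_inv_cancel γ) D
  obtain ⟨hT', g', hg', hgq⟩ := h D'
  refine ⟨(signedSelmerDualData_isTorsion_inv_iff D D').2 hT', IwasawaAlgebra.invol p g' * ↑(hu.unit⁻¹), ?_, ?_⟩
  · rw [(signedSelmerDualData_charIdeal_inv_eq_span_iff D D' g').1 hg']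
    exact (Ideal.span_singleton_mul_right_unit (Units.isUnit _) _).symm
  · have hx : iwasawaToPowerSeries p g' = C c * iwasawaToPowerSeries p (L * 1) := by rw [mul_one, hgq]
    have key := iwasawaToPowerSeries_invol_of_eq hFE hx
    rw [map_one, mul_one] at key
    rw [map_mul, key, map_mul, mul_assoc, mul_assoc, ← map_mul, ← map_mul, IsUnit.mul_val_inv, mul_one]

/-- **MC shape, tree-keyed ⇒ contragredient** (the same door read backwards: a key-`γ⁻¹` datum is the twist of a
key-`γ` one, `signedSelmerDualData_exists_involTwist (inv_mul_cancel γ)`). [cite: GreenbergLNM1716, §1 (p. 60)]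
[cite: Kobayashi2003, Conjecture (Main Conjecture) (p. 2) (the shape only)] -/
theorem mcShape_inv_of {L u : IwasawaAlgebra p} (hu : IsUnit u) (hFE : IwasawaAlgebra.invol p L = u * L)
    (c : ℚ_[p])
    (h : ∀ D : SignedSelmerDualData W κ γ ε, Module.IsTorsion (IwasawaAlgebra p) D.X ∧
      ∃ g : IwasawaAlgebra p, D.charIdeal = Ideal.span {g} ∧
        iwasawaToPowerSeries p g = C c * iwasawaToPowerSeries p L)
    (D' : SignedSelmerDualData W κ γ⁻¹ ε) :
    Module.IsTorsion (IwasawaAlgebra p) D'.X ∧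
      ∃ g : IwasawaAlgebra p, D'.charIdeal = Ideal.span {g} ∧
        iwasawaToPowerSeries p g = C c * iwasawaToPowerSeries p L := by
  obtain ⟨D, -, -, -⟩ := signedSelmerDualData_exists_involTwist (inv_mul_cancel γ) D'
  obtain ⟨hT, g, hg, hgq⟩ := h D
  refine ⟨(signedSelmerDualData_isTorsion_inv_iff D D').1 hT, IwasawaAlgebra.invol p g * ↑(hu.unit⁻¹), ?_, ?_⟩
  · have h1 : D.charIdeal = Ideal.span {IwasawaAlgebra.invol p (IwasawaAlgebra.invol p g)} := by
      rw [IwasawaAlgebra.invol_invol]; exact hg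
    rw [(signedSelmerDualData_charIdeal_inv_eq_span_iff D D' (IwasawaAlgebra.invol p g)).2 h1]
    exact (Ideal.span_singleton_mul_right_unit (Units.isUnit _) _).symm
  · have hx : iwasawaToPowerSeries p g = C c * iwasawaToPowerSeries p (L * 1) := by rw [mul_one, hgq]
    have key := iwasawaToPowerSeries_invol_of_eq hFE hx
    rw [map_one, mul_one] at key
    rw [map_mul, key, map_mul, mul_assoc, mul_assoc, ← map_mul, ← map_mul, IsUnit.mul_val_inv, mul_one]

/-- **Lower (Eisenstein) shape, contragredient ⇒ tree-keyed**: `char = (g′)`, `g′^ℚ = C c · (L h′)^ℚ` for every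
key-`γ⁻¹` datum gives the same for every key-`γ` datum, with `g := ι g′`, `h := u · ι h′`.
[cite: GreenbergLNM1716, §1 (p. 60)] [cite: Kobayashi2003, Conjecture (Main Conjecture) (p. 2) (the shape only)] -/
theorem lowerShape_of_inv {L u : IwasawaAlgebra p} (hFE : IwasawaAlgebra.invol p L = u * L) (c : ℚ_[p])
    (h : ∀ D' : SignedSelmerDualData W κ γ⁻¹ ε, ∃ g h : IwasawaAlgebra p, D'.charIdeal = Ideal.span {g} ∧
        iwasawaToPowerSeries p g = C c * iwasawaToPowerSeries p (L * h))
    (D : SignedSelmerDualData W κ γ ε) :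
    ∃ g h : IwasawaAlgebra p, D.charIdeal = Ideal.span {g} ∧
      iwasawaToPowerSeries p g = C c * iwasawaToPowerSeries p (L * h) := by
  obtain ⟨D', -, -, -⟩ := signedSelmerDualData_exists_involTwist (mul_inv_cancel γ) D
  obtain ⟨g', h', hg', hgq⟩ := h D'
  exact ⟨IwasawaAlgebra.invol p g', u * IwasawaAlgebra.invol p h',
    (signedSelmerDualData_charIdeal_inv_eq_span_iff D D' g').1 hg', iwasawaToPowerSeries_invol_of_eq hFE hgq⟩

/-- **Lower (Eisenstein) shape, tree-keyed ⇒ contragredient.** [cite: GreenbergLNM1716, §1 (p. 60)]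
[cite: Kobayashi2003, Conjecture (Main Conjecture) (p. 2) (the shape only)] -/
theorem lowerShape_inv_of {L u : IwasawaAlgebra p} (hFE : IwasawaAlgebra.invol p L = u * L) (c : ℚ_[p])
    (h : ∀ D : SignedSelmerDualData W κ γ ε, ∃ g h : IwasawaAlgebra p, D.charIdeal = Ideal.span {g} ∧
        iwasawaToPowerSeries p g = C c * iwasawaToPowerSeries p (L * h))
    (D' : SignedSelmerDualData W κ γ⁻¹ ε) :
    ∃ g h : IwasawaAlgebra p, D'.charIdeal = Ideal.span {g} ∧
      iwasawaToPowerSeries p g = C c * iwasawaToPowerSeries p (L * h) := by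
  obtain ⟨D, -, -, -⟩ := signedSelmerDualData_exists_involTwist (inv_mul_cancel γ) D'
  obtain ⟨g, h, hg, hgq⟩ := h D
  have h1 : D.charIdeal = Ideal.span {IwasawaAlgebra.invol p (IwasawaAlgebra.invol p g)} := by
    rw [IwasawaAlgebra.invol_invol]; exact hg
  exact ⟨IwasawaAlgebra.invol p g, u * IwasawaAlgebra.invol p h,
    (signedSelmerDualData_charIdeal_inv_eq_span_iff D D' (IwasawaAlgebra.invol p g)).2 h1,
    iwasawaToPowerSeries_invol_of_eq hFE hgq⟩

/-- **`p`-inverted `λ`-shape (child 23118 / crux 3's residual), contragredient ⇒ tree-keyed**: `char = (g′)`,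
`(C p^m · g′)^ℚ = C c · (L h′)^ℚ` for every key-`γ⁻¹` datum gives the same (same `m`) for every key-`γ` datum
(`ι` fixes `C p^m`). [cite: GreenbergLNM1716, §1 (p. 60)] [cite: Kobayashi2003, Conjecture (Main Conjecture) (p. 2) (the shape only)] -/
theorem lambdaShape_of_inv {L u : IwasawaAlgebra p} (hFE : IwasawaAlgebra.invol p L = u * L) (c : ℚ_[p])
    (h : ∀ D' : SignedSelmerDualData W κ γ⁻¹ ε, ∃ (g h : IwasawaAlgebra p) (m : ℕ),
      D'.charIdeal = Ideal.span {g} ∧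
        iwasawaToPowerSeries p (C ((p : ℤ_[p]) ^ m) * g) = C c * iwasawaToPowerSeries p (L * h))
    (D : SignedSelmerDualData W κ γ ε) :
    ∃ (g h : IwasawaAlgebra p) (m : ℕ), D.charIdeal = Ideal.span {g} ∧
      iwasawaToPowerSeries p (C ((p : ℤ_[p]) ^ m) * g) = C c * iwasawaToPowerSeries p (L * h) := by
  obtain ⟨D', -, -, -⟩ := signedSelmerDualData_exists_involTwist (mul_inv_cancel γ) D
  obtain ⟨g', h', m, hg', hgq⟩ := h D'
  refine ⟨IwasawaAlgebra.invol p g', u * IwasawaAlgebra.invol p h', m,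
    (signedSelmerDualData_charIdeal_inv_eq_span_iff D D' g').1 hg', ?_⟩
  have key := iwasawaToPowerSeries_invol_of_eq hFE hgq
  rwa [map_mul (IwasawaAlgebra.invol p), IwasawaAlgebra.invol_C] at key

/-- **`p`-inverted `λ`-shape, tree-keyed ⇒ contragredient.** [cite: GreenbergLNM1716, §1 (p. 60)]
[cite: Kobayashi2003, Conjecture (Main Conjecture) (p. 2) (the shape only)] -/
theorem lambdaShape_inv_of {L u : IwasawaAlgebra p} (hFE : IwasawaAlgebra.invol p L = u * L) (c : ℚ_[p])
    (h : ∀ D : SignedSelmerDualData W κ γ ε, ∃ (g h : IwasawaAlgebra p) (m : ℕ),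
      D.charIdeal = Ideal.span {g} ∧
        iwasawaToPowerSeries p (C ((p : ℤ_[p]) ^ m) * g) = C c * iwasawaToPowerSeries p (L * h))
    (D' : SignedSelmerDualData W κ γ⁻¹ ε) :
    ∃ (g h : IwasawaAlgebra p) (m : ℕ), D'.charIdeal = Ideal.span {g} ∧
      iwasawaToPowerSeries p (C ((p : ℤ_[p]) ^ m) * g) = C c * iwasawaToPowerSeries p (L * h) := by
  obtain ⟨D, -, -, -⟩ := signedSelmerDualData_exists_involTwist (inv_mul_cancel γ) D'
  obtain ⟨g, h, m, hg, hgq⟩ := h D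
  have h1 : D.charIdeal = Ideal.span {IwasawaAlgebra.invol p (IwasawaAlgebra.invol p g)} := by
    rw [IwasawaAlgebra.invol_invol]; exact hg
  refine ⟨IwasawaAlgebra.invol p g, u * IwasawaAlgebra.invol p h, m,
    (signedSelmerDualData_charIdeal_inv_eq_span_iff D D' (IwasawaAlgebra.invol p g)).2 h1, ?_⟩
  have key := iwasawaToPowerSeries_invol_of_eq hFE hgq
  rwa [map_mul (IwasawaAlgebra.invol p), IwasawaAlgebra.invol_C] at key

end Shapes

end Summit.BirchSwinnertonDyer.BirchSwinnertonDyer.Theorems.KobayashiKeyingDoor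

end
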